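import Literature.AlgebraicGeometry.Resolution.WeightedResolutionDatum
import Literature.AlgebraicGeometry.Resolution.CobordantBlowupRegular
import Summits.ResolutionOfSingularities.ResolutionOfSingularities.Theorems.WeightedInvariantWeightedConstructionExtReesWeighted
import HarnessLib

/-!
# The extended Rees algebra of a weighted chart: generators, exceptional fibre, vertex

Topic: `Summits/ResolutionOfSingularities/ResolutionOfSingularities/Theorems`. Helpers (part 2 of 3) for
the stub `stub_formalChart` (formal-chart package) of the line `support-first-weights-second` of the crux
`Theses.WeightedInvariant.WeightedConstruction` (statement `stmt-ResolutionOfSingularities-0571`). For the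
datum file's extended Rees algebra `extReesAlgebra I` of a weighted chart (`Iₙ = (u^α : Σ wᵢ αᵢ ≥ n)`,
identified with the tree's `cobordantAlgebra u w = A[t⁻¹, uᵢ t^{wᵢ}]` by `stub_extReesAlgebra_weighted`),
with its elements `uᵢ' = uᵢ t^{wᵢ}` (any `u'` with these underlying Laurent polynomials):

* `cobordantAlgebra_exists_quotient_equiv` / `extRees_exists_quotient_equiv` — the exceptional fibre ring
  `A[t⁻¹, uᵢ t^{wᵢ}]/(t⁻¹) ≅ (A/(u))[X₁, …, Xₘ]` EXPLICITLY: `uᵢ' ↦ Xᵢ`, `a ↦ a mod (u)` (Włodarczyk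
  §2.3.9: the exceptional divisor is the weighted normal bundle `Spec (𝒪/(u))[u']`; the tree's
  `cobordantAlgebra.nonempty_quotient_span_s_equiv` only records existence);
* `algebraMap_u_eq_tInv_pow_mul` (`uᵢ = (t⁻¹)^{wᵢ} uᵢ'`), `isNoetherianRing_extReesAlgebra`,
  `tInv_mem_nonZeroDivisors`, `extRees_exists_sub_algebraMap_mem` (every element is a constant modulo
  `(t⁻¹, uᵢ' − cᵢ)`);
* `vertexIdeal_le_span_u'` — the vertex ideal lies in `(u₁', …, uₘ')`.

## Sources

* J. Włodarczyk, *Functorial resolution by torus actions*, arXiv:2203.03090, Def. 2.3.5, §2.3.9, §4.1.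
  [Wlodarczyk2022]
-/

noncomputable section

open CategoryTheory CategoryTheory.Limits AlgebraicGeometry TopologicalSpace
open Literature.AlgebraicGeometry.Resolution IsLocalRing
open scoped LaurentPolynomial

-- the summit namespace repeats `ResolutionOfSingularities` by design
set_option linter.dupNamespace false

namespace Summit.ResolutionOfSingularities.ResolutionOfSingularities.Theorems

universe u

/-! ## The exceptional fibre ring `𝒪_B/(s) ≅ (A/(u))[X]`, with its values on the generators -/

section CobordantFibre

variable {A : Type u} [CommRing A] {m : ℕ} (u : Fin m → A) (w : Fin m → ℕ)

/-- **The exceptional fibre ring, explicitly**: under weighted quasi-regularity of `u` there is a ring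
isomorphism `A[t⁻¹, uᵢ t^{wᵢ}]/(t⁻¹) ≅ (A/(u))[X₁, …, Xₘ]` taking the class of `P(u₁', …, uₘ')` to
`P mod (u)` — so `uᵢ' ↦ Xᵢ` and `a ↦ a mod (u)` (Włodarczyk §2.3.9: `V(s) = Spec (𝒪_X/(u))[u']`; the
tree's `cobordantAlgebra.nonempty_quotient_span_s_equiv` records only the existence of an isomorphism).
[cite: Wlodarczyk2022, §2.3.9] -/
theorem cobordantAlgebra_exists_quotient_equiv (hw : ∀ i, 0 < w i)
    (hwqr : ∀ (n : ℕ) (P : MvPolynomial (Fin m) A), P.IsWeightedHomogeneous w n →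
      MvPolynomial.eval u P ∈ (weightedFiltration u w).ideal (n + 1) →
        ∀ β, P.coeff β ∈ Ideal.span (Set.range u)) :
    ∃ e : (cobordantAlgebra u w ⧸ Ideal.span {cobordantAlgebra.s u w}) ≃+*
        MvPolynomial (Fin m) (A ⧸ Ideal.span (Set.range u)),
      ∀ P : MvPolynomial (Fin m) A,
        e (Ideal.Quotient.mk _ (MvPolynomial.aeval (cobordantAlgebra.u' u w) P)) =
          MvPolynomial.map (Ideal.Quotient.mk _) P := by
  classical
  set ψ : MvPolynomial (Fin m) A →+* cobordantAlgebra u w ⧸ Ideal.span {cobordantAlgebra.s u w} :=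
    (Ideal.Quotient.mk (Ideal.span {cobordantAlgebra.s u w})).comp
      (MvPolynomial.aeval (cobordantAlgebra.u' u w) :
        MvPolynomial (Fin m) A →ₐ[A] cobordantAlgebra u w).toRingHom with hψ
  have hker : RingHom.ker ψ =
      Ideal.map (MvPolynomial.C : A →+* MvPolynomial (Fin m) A) (Ideal.span (Set.range u)) := by
    ext P
    rw [RingHom.mem_ker, hψ, RingHom.comp_apply, Ideal.Quotient.eq_zero_iff_mem]
    exact cobordantAlgebra.aeval_u'_mem_span_s_iff_coeff_mem u w hw hwqr P
  have hsurj : Function.Surjective ψ := cobordantAlgebra.mk_comp_aeval_u'_surjective u w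
  let e1 := RingHom.quotientKerEquivOfSurjective hsurj
  let e2 := Ideal.quotEquivOfEq hker
  let e3 := (MvPolynomial.quotientEquivQuotientMvPolynomial (σ := Fin m)
    (Ideal.span (Set.range u))).toRingEquiv
  refine ⟨(e1.symm.trans e2).trans e3.symm, fun P => ?_⟩
  have h1 : e1.symm (ψ P) = Ideal.Quotient.mk _ P := by
    rw [RingEquiv.symm_apply_eq]
    exact (RingHom.quotientKerEquivOfSurjective_apply_mk hsurj P).symm
  have hψP : Ideal.Quotient.mk _ (MvPolynomial.aeval (cobordantAlgebra.u' u w) P) = ψ P := rfl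
  rw [hψP, RingEquiv.trans_apply, RingEquiv.trans_apply, h1, Ideal.quotEquivOfEq_mk]
  change Ideal.Quotient.lift (Ideal.map MvPolynomial.C (Ideal.span (Set.range u)))
    (MvPolynomial.eval₂Hom (MvPolynomial.C.comp (Ideal.Quotient.mk (Ideal.span (Set.range u))))
      MvPolynomial.X) (fun _ ha => MvPolynomial.eval₂_C_mk_eq_zero ha) (Ideal.Quotient.mk _ P) = _
  rw [Ideal.Quotient.lift_mk, MvPolynomial.map_eq_eval₂Hom_C_comp]

end CobordantFibre

/-! ## The extended Rees algebra of a weighted chart: elements and structure -/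

section ExtRees

open LaurentPolynomial

variable {A : Type u} [CommRing A] {m : ℕ} {u : Fin m → A} {w : Fin m → ℕ} {I : ℕ → Ideal A}
  (hE : extReesAlgebra I = cobordantAlgebra u w) (u' : Fin m → ↥(extReesAlgebra I))
  (hu' : ∀ i, (u' i : A[T;T⁻¹]) = C (u i) * T (w i : ℤ))

/-- `Subalgebra.equivOfEq` does not change the underlying element. [folklore] -/
theorem Subalgebra_coe_equivOfEq_apply {R B : Type*} [CommSemiring R] [Semiring B] [Algebra R B]
    (S₁ S₂ : Subalgebra R B) (h : S₁ = S₂) (x : S₁) : ((Subalgebra.equivOfEq S₁ S₂ h x : S₂) : B) = x :=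
  rfl

/-- `t⁻¹ ↦ s` under the identification of the datum's extended Rees algebra with the tree's cobordant
algebra (both are the same subalgebra of `A[t, t⁻¹]`). [folklore] -/
theorem equivOfEq_tInv : Subalgebra.equivOfEq _ _ hE (extReesAlgebra.tInv I) = cobordantAlgebra.s u w := rfl

include hu' in
/-- The elements `uᵢ' = uᵢ t^{wᵢ}` (the generators of Włodarczyk §2.3.9) go to the tree's `cobordantAlgebra.u'`.
[cite: Wlodarczyk2022, §2.3.9] -/
theorem equivOfEq_u' (i : Fin m) : Subalgebra.equivOfEq _ _ hE (u' i) = cobordantAlgebra.u' u w i :=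
  Subtype.ext ((Subalgebra_coe_equivOfEq_apply _ _ hE (u' i)).trans (hu' i))

include hE hu' in
/-- **The local equations of `B`**: `uᵢ = (t⁻¹)^{wᵢ} · uᵢ'` in the extended Rees algebra
(Włodarczyk §2.3.9). [cite: Wlodarczyk2022, §2.3.9] -/
theorem algebraMap_u_eq_tInv_pow_mul (i : Fin m) :
    algebraMap A (extReesAlgebra I) (u i) = extReesAlgebra.tInv I ^ w i * u' i := by
  apply (Subalgebra.equivOfEq _ _ hE).injective
  rw [AlgEquiv.commutes, map_mul, map_pow, equivOfEq_tInv hE, equivOfEq_u' hE u' hu',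
    cobordantAlgebra.algebraMap_u]

include hE hu' in
/-- `uᵢ = (t⁻¹)^{wᵢ} · ((uᵢ' − cᵢ) + cᵢ)`: the local equation of `B` recentred at an exceptional point.
[cite: Wlodarczyk2022, §2.3.9] -/
theorem algebraMap_u_eq_tInv_pow_mul_sub_add (c : Fin m → A) (i : Fin m) :
    algebraMap A (extReesAlgebra I) (u i) = extReesAlgebra.tInv I ^ w i *
      ((u' i - algebraMap A (extReesAlgebra I) (c i)) + algebraMap A (extReesAlgebra I) (c i)) := by
  rw [algebraMap_u_eq_tInv_pow_mul hE u' hu', sub_add_cancel]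

include hE in
/-- The extended Rees algebra of a weighted chart over a Noetherian ring is Noetherian. [folklore] -/
theorem isNoetherianRing_extReesAlgebra [IsNoetherianRing A] : IsNoetherianRing ↥(extReesAlgebra I) := by
  rw [hE]
  exact cobordantAlgebra.isNoetherianRing u w

/-- `t⁻¹` is a non-zero-divisor of the extended Rees algebra (a unit of `A[t, t⁻¹]`). [folklore] -/
theorem tInv_mem_nonZeroDivisors (I : ℕ → Ideal A) :
    extReesAlgebra.tInv I ∈ nonZeroDivisors ↥(extReesAlgebra I) := by
  rw [mem_nonZeroDivisors_iff_right]
  intro f hf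
  apply Subtype.ext
  have h := congrArg Subtype.val hf
  rw [MulMemClass.coe_mul, extReesAlgebra.coe_tInv, ZeroMemClass.coe_zero] at h
  simpa using (LaurentPolynomial.isUnit_T (-1 : ℤ)).mul_left_eq_zero.mp h

include hE hu' in
/-- **The exceptional fibre ring of the extended Rees algebra of a weighted chart**:
`A[t⁻¹, Rₙ tⁿ]/(t⁻¹) ≅ (A/(u))[X₁, …, Xₘ]`, `uᵢ' ↦ Xᵢ`, `a ↦ a mod (u)`.
[cite: Wlodarczyk2022, §2.3.9] -/
theorem extRees_exists_quotient_equiv (hw : ∀ i, 0 < w i)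
    (hwqr : ∀ (n : ℕ) (P : MvPolynomial (Fin m) A), P.IsWeightedHomogeneous w n →
      MvPolynomial.eval u P ∈ (weightedFiltration u w).ideal (n + 1) →
        ∀ β, P.coeff β ∈ Ideal.span (Set.range u)) :
    ∃ e : (↥(extReesAlgebra I) ⧸ Ideal.span {extReesAlgebra.tInv I}) ≃+*
        MvPolynomial (Fin m) (A ⧸ Ideal.span (Set.range u)),
      (∀ i, e (Ideal.Quotient.mk _ (u' i)) = MvPolynomial.X i) ∧
      ∀ a : A, e (Ideal.Quotient.mk _ (algebraMap A _ a)) =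
        MvPolynomial.C (Ideal.Quotient.mk _ a) := by
  obtain ⟨e, he⟩ := cobordantAlgebra_exists_quotient_equiv u w hw hwqr
  let θ := (Subalgebra.equivOfEq _ _ hE).toRingEquiv
  have hθ : Ideal.span {cobordantAlgebra.s u w} =
      (Ideal.span {extReesAlgebra.tInv I}).map (θ : ↥(extReesAlgebra I) →+* ↥(cobordantAlgebra u w)) := by
    rw [Ideal.map_span, Set.image_singleton]
    rfl
  let e0 := Ideal.quotientEquiv _ _ θ hθ
  refine ⟨e0.trans e, fun i => ?_, fun a => ?_⟩
  · rw [RingEquiv.trans_apply, Ideal.quotientEquiv_apply, RingHom.toFun_eq_coe,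
      Ideal.quotientMap_mk]
    have := he (MvPolynomial.X i)
    rw [MvPolynomial.aeval_X, MvPolynomial.map_X] at this
    convert this using 3
    exact equivOfEq_u' hE u' hu' i
  · rw [RingEquiv.trans_apply, Ideal.quotientEquiv_apply, RingHom.toFun_eq_coe,
      Ideal.quotientMap_mk]
    have := he (MvPolynomial.C a)
    rw [MvPolynomial.algHom_C, MvPolynomial.map_C] at this
    convert this using 3
    exact (Subalgebra.equivOfEq _ _ hE).commutes a

include hE hu' in
/-- **Generation of `B` over the base modulo the coordinates of an exceptional point**: every element
of `A[t⁻¹, uᵢ t^{wᵢ}]` is congruent to an element of `A` modulo the ideal `(t⁻¹, uᵢ' − cᵢ)` (the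
algebra is generated over `A` by `t⁻¹` and the `uᵢ'`). [folklore] -/
theorem extRees_exists_sub_algebraMap_mem (c : Fin m → A) (J : Ideal ↥(extReesAlgebra I))
    (hs : extReesAlgebra.tInv I ∈ J) (hu : ∀ i, u' i - algebraMap A _ (c i) ∈ J)
    (x : ↥(extReesAlgebra I)) : ∃ a : A, x - algebraMap A _ a ∈ J := by
  let θ := Subalgebra.equivOfEq _ _ hE
  suffices h : ∀ y : ↥(cobordantAlgebra u w), ∃ a : A, θ.symm y - algebraMap A _ a ∈ J by
    simpa using h (θ x)
  intro y
  induction y using cobordantAlgebra.induction_on with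
  | algebraMap a => exact ⟨a, by rw [AlgEquiv.commutes, sub_self]; exact J.zero_mem⟩
  | s => exact ⟨0, by rw [map_zero, sub_zero]; exact hs⟩
  | u' i =>
    refine ⟨c i, ?_⟩
    rw [← equivOfEq_u' hE u' hu' i, AlgEquiv.symm_apply_apply]
    exact hu i
  | add f g hf hg =>
    obtain ⟨a, ha⟩ := hf
    obtain ⟨b, hb⟩ := hg
    refine ⟨a + b, ?_⟩
    rw [map_add, map_add]
    convert J.add_mem ha hb using 1
    ring
  | mul f g hf hg =>
    obtain ⟨a, ha⟩ := hf
    obtain ⟨b, hb⟩ := hg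
    refine ⟨a * b, ?_⟩
    rw [map_mul, map_mul]
    have : θ.symm f * θ.symm g - algebraMap A _ a * algebraMap A _ b =
        θ.symm f * (θ.symm g - algebraMap A _ b) + (θ.symm f - algebraMap A _ a) * algebraMap A _ b := by
      ring
    rw [this]
    exact J.add_mem (J.mul_mem_left _ hb) (J.mul_mem_right _ ha)

end ExtRees

/-! ## The vertex ideal is generated by the `uᵢ'` -/

section Vertex

open LaurentPolynomial

variable {A : Type} [CommRing A] {m : ℕ} (u : Fin m → A) (w : Fin m → ℕ)

/-- An element `a tⁿ` of `A[t⁻¹, uᵢ t^{wᵢ}]` with `n ≥ 1` and `a ∈ (u^α : Σ wᵢ αᵢ ≥ n)` lies in the ideal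
`(u₁', …, uₘ')` of the vertex: `u^α tⁿ = (∏ uᵢ'^{αᵢ}) s^{Σ wᵢαᵢ − n}` with some `αᵢ ≥ 1`. [folklore] -/
theorem cobordantAlgebra_mem_span_u'_of_coe {n : ℕ} (hn : 0 < n) {a : A}
    (ha : a ∈ weightedMonomialIdeal u w n) (y : cobordantAlgebra u w)
    (hy : (y : A[T;T⁻¹]) = C a * T (n : ℤ)) :
    y ∈ Ideal.span (Set.range (cobordantAlgebra.u' u w)) := by
  induction ha using Submodule.span_induction generalizing y with
  | mem x hx =>
    obtain ⟨α, hα, rfl⟩ := hx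
    set N := ∑ i, w i * α i with hN
    -- `y = (∏ uᵢ'^{αᵢ}) · s^{N - n}`
    have hyeq : y = (∏ i, cobordantAlgebra.u' u w i ^ α i) * cobordantAlgebra.s u w ^ (N - n) := by
      apply Subtype.ext
      rw [hy, MulMemClass.coe_mul, cobordantAlgebra.coe_s_pow, SubmonoidClass.coe_finsetProd]
      simp_rw [SubmonoidClass.coe_pow, cobordantAlgebra.coe_u']
      rw [← extReesWeighted_C_prod_pow_mul_T_eq, mul_assoc, ← T_add]
      congr 2
      rw [← hN, Nat.cast_sub hα]
      ring
    -- some exponent is positive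
    obtain ⟨i, hi⟩ : ∃ i, 0 < α i := by
      by_contra hcon
      push Not at hcon
      have hsum : N = 0 := Finset.sum_eq_zero fun j _ => by rw [Nat.le_zero.mp (hcon j), mul_zero]
      omega
    rw [hyeq, ← Finset.mul_prod_erase Finset.univ (fun j => cobordantAlgebra.u' u w j ^ α j)
      (Finset.mem_univ i)]
    refine Ideal.mul_mem_right _ _ (Ideal.mul_mem_right _ _ ?_)
    exact Ideal.pow_mem_of_mem (Ideal.span _) (Ideal.subset_span (Set.mem_range_self i)) _ hi
  | zero =>
    have : y = 0 := Subtype.ext (by rw [hy, map_zero, zero_mul, ZeroMemClass.coe_zero])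
    rw [this]
    exact Ideal.zero_mem _
  | add a b ha' hb' iha ihb =>
    let ya : cobordantAlgebra u w := ⟨C a * T (n : ℤ), extReesWeighted_C_mul_T_mem_of_mem u w ha'⟩
    let yb : cobordantAlgebra u w := ⟨C b * T (n : ℤ), extReesWeighted_C_mul_T_mem_of_mem u w hb'⟩
    have : y = ya + yb := Subtype.ext (by
      rw [hy, AddMemClass.coe_add, map_add, add_mul])
    rw [this]
    exact Ideal.add_mem _ (iha ya rfl) (ihb yb rfl)
  | smul r a ha' ih =>
    let ya : cobordantAlgebra u w := ⟨C a * T (n : ℤ), extReesWeighted_C_mul_T_mem_of_mem u w ha'⟩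
    have : y = algebraMap A (cobordantAlgebra u w) r * ya := Subtype.ext (by
      rw [hy, MulMemClass.coe_mul, cobordantAlgebra.coe_algebraMap, smul_eq_mul, map_mul, mul_assoc])
    rw [this]
    exact Ideal.mul_mem_left _ _ (ih ya rfl)

/-- **The vertex ideal of the extended Rees algebra of a weighted chart is contained in
`(u₁', …, uₘ')`** (in fact equal; Włodarczyk Def. 2.3.5: `Vert(B) = V(u₁ t^{w₁}, …, uₘ t^{wₘ})`).
[cite: Wlodarczyk2022, Def. 2.3.5] -/
theorem vertexIdeal_le_span_u' {I : ℕ → Ideal A} (hE : extReesAlgebra I = cobordantAlgebra u w)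
    (u' : Fin m → ↥(extReesAlgebra I)) (hu' : ∀ i, (u' i : A[T;T⁻¹]) = C (u i) * T (w i : ℤ))
    (hIn : ∀ n, I n = weightedMonomialIdeal u w n) :
    extReesAlgebra.vertexIdeal I ≤ Ideal.span (Set.range u') := by
  rw [extReesAlgebra.vertexIdeal, Ideal.span_le]
  rintro x ⟨n, hn, a, ha, hx⟩
  have ha' : a ∈ weightedMonomialIdeal u w n := hIn n ▸ ha
  have hx' : ((Subalgebra.equivOfEq _ _ hE x : ↥(cobordantAlgebra u w)) : A[T;T⁻¹]) = C a * T (n : ℤ) := by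
    rw [Subalgebra_coe_equivOfEq_apply]; exact hx
  have h := cobordantAlgebra_mem_span_u'_of_coe u w hn ha' (Subalgebra.equivOfEq _ _ hE x) hx'
  rw [SetLike.mem_coe, ← (Subalgebra.equivOfEq _ _ hE).symm_apply_apply x]
  have hmap : (Ideal.span (Set.range (cobordantAlgebra.u' u w))).map
      ((Subalgebra.equivOfEq _ _ hE).symm : ↥(cobordantAlgebra u w) →+* ↥(extReesAlgebra I)) ≤
        Ideal.span (Set.range u') := by
    rw [Ideal.map_span, Ideal.span_le]
    rintro _ ⟨_, ⟨i, rfl⟩, rfl⟩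
    refine Ideal.subset_span ⟨i, ?_⟩
    change u' i = (Subalgebra.equivOfEq _ _ hE).symm (cobordantAlgebra.u' u w i)
    rw [← equivOfEq_u' hE u' hu' i, AlgEquiv.symm_apply_apply]
  exact hmap (Ideal.mem_map_of_mem _ h)

end Vertex

/-! ## Registered anchor of this helper file -/

/-- Registered anchor (`stub_formalChart_algebra`, helper 2/3 of `stub_formalChart`): the exceptional fibre ring of
the cobordant algebra, explicitly (`cobordantAlgebra_exists_quotient_equiv`, at `Type`). [cite: Wlodarczyk2022, §2.3.9] -/
theorem stub_formalChart_algebra : ∀ {A : Type} [CommRing A] {m : ℕ} (u : Fin m → A) (w : Fin m → ℕ), (∀ i, 0 < w i) → (∀ (n : ℕ) (P : MvPolynomial (Fin m) A), P.IsWeightedHomogeneous w n → MvPolynomial.eval u P ∈ (weightedFiltration u w).ideal (n + 1) → ∀ β, P.coeff β ∈ Ideal.span (Set.range u)) → ∃ e : (cobordantAlgebra u w ⧸ Ideal.span {cobordantAlgebra.s u w}) ≃+* MvPolynomial (Fin m) (A ⧸ Ideal.span (Set.range u)), ∀ P : MvPolynomial (Fin m) A, e (Ideal.Quotient.mk _ (MvPolynomial.aeval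 (cobordantAlgebra.u' u w) P)) = MvPolynomial.map (Ideal.Quotient.mk _) P :=
  fun u w hw hwqr => cobordantAlgebra_exists_quotient_equiv u w hw hwqr

end Summit.ResolutionOfSingularities.ResolutionOfSingularities.Theorems

end
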